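import Mathlib.GroupTheory.DoubleCoset
import Mathlib.CategoryTheory.Galois.Basic
import Literature.AnabelianGeometry.Anabelioids.Basic
import HarnessLib

/-!
# Anabelioids: double cosets ↔ orbits, and transport of the `π₁`-action along an identification of basepoints

Mochizuki, *Semi-graphs of anabelioids*, Publ. RIMS **42** (2006), §2, Definition 2.2 (i) p. 23 and
Remark 2.2.1 p. 24: along a finite étale covering the vertices / branches upstairs are read as orbits,
i.e. as double cosets `Π_{v'} \ Π_v / Π_b` of the decomposition groups ("stabilizers")
[cite: MochizukiSemiAnbd2006, Rem. 2.2.1 p.24]; [SGA1, Exp. V §4–5].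

PROOF-ONLY toolkit (abc-iut cell, L3 row G23 (d) step 2, discharge of
`covering_branchFibre_doubleCosets`, abc-iut-L6-t17):

* `doubleCoset_mk_stabilizer_eq_iff` — for a group `G` acting on `X`, `s₀ ∈ X` and `K ≤ G`:
  `Stab(s₀)·x·K = Stab(s₀)·y·K ↔ y⁻¹ s₀ ∈ K·(x⁻¹ s₀)` (double cosets by a point stabiliser on the
  left are the `K`-orbits of the orbit of `s₀`, read through `x ↦ x⁻¹ s₀`);
* `transport_smul_app` — for functors `P : C ⥤ E`, basepoints `Fe` of `E`, `F` of `C` and an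
  identification `α : P ⋙ Fe ≅ F`, the bijections `α_X : Fe(P X) ≃ F(X)` are equivariant along
  `j := Aut(α) ∘ π₁(P) : Aut Fe → Aut F`;
* `mem_orbit_range_iff_of_transport` — hence `α_X` matches `Aut Fe`-orbits on `Fe(P X)` with
  `j(Aut Fe)`-orbits on `F(X)`;
* `mem_orbit_of_map_mem_orbit` — orbits pull back along the (injective, equivariant) fibre map of a
  monomorphism.
-/

namespace Literature.AnabelianGeometry.Anabelioids

open CategoryTheory CategoryTheory.PreGaloisCategory
open scoped Pointwise

universe w u₁ u₂ u₃ u₄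

section Group

variable {G : Type*} [Group G] {X : Type*} [MulAction G X]

/-- **Double cosets by a stabiliser are orbits.** For `s₀ ∈ X` and a subgroup `K`, two elements
`x, y` lie in the same double coset `Stab(s₀) \ G / K` iff `y⁻¹ • s₀` lies in the `K`-orbit of
`x⁻¹ • s₀` ([SemiAnbd] Rem. 2.2.1: double cosets of decomposition groups = orbits).
[cite: MochizukiSemiAnbd2006, Rem. 2.2.1 p.24] -/
theorem doubleCoset_mk_stabilizer_eq_iff (s₀ : X) (K : Subgroup G) (x y : G) :
    DoubleCoset.mk (MulAction.stabilizer G s₀) K x = DoubleCoset.mk (MulAction.stabilizer G s₀) K y ↔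
      y⁻¹ • s₀ ∈ MulAction.orbit K (x⁻¹ • s₀) := by
  rw [DoubleCoset.eq, MulAction.mem_orbit_iff]
  constructor
  · rintro ⟨h, hh, k, hk, rfl⟩
    refine ⟨⟨k⁻¹, K.inv_mem hk⟩, ?_⟩
    have hh' : h⁻¹ • s₀ = s₀ :=
      MulAction.mem_stabilizer_iff.mp ((MulAction.stabilizer G s₀).inv_mem hh)
    rw [Subgroup.mk_smul, mul_inv_rev, mul_inv_rev, mul_smul, mul_smul, hh']
  · rintro ⟨⟨k, hk⟩, hk'⟩
    rw [Subgroup.mk_smul] at hk'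
    refine ⟨y * k * x⁻¹, ?_, k⁻¹, K.inv_mem hk, by group⟩
    rw [MulAction.mem_stabilizer_iff, mul_smul, mul_smul, hk', smul_inv_smul]

/-- The same, with the double coset of `x` on the right and a point `s` given directly:
`Stab(s₀)·x·K ∋` the class of any `y` with `y⁻¹ s₀ = s` iff `s ∈ K·(x⁻¹ s₀)`.
[cite: MochizukiSemiAnbd2006, Rem. 2.2.1 p.24] -/
theorem doubleCoset_mk_stabilizer_eq_of_inv_smul (s₀ : X) (K : Subgroup G) (x y : G)
    (h : y⁻¹ • s₀ ∈ MulAction.orbit K (x⁻¹ • s₀)) :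
    DoubleCoset.mk (MulAction.stabilizer G s₀) K y = DoubleCoset.mk (MulAction.stabilizer G s₀) K x :=
  ((doubleCoset_mk_stabilizer_eq_iff s₀ K x y).mpr h).symm


/-- **Double cosets by a stabiliser on the RIGHT are orbits.** For `s₀ ∈ X` and a subgroup `H`,
`x, y` lie in the same double coset `H \ G / Stab(s₀)` iff `y • s₀` lies in the `H`-orbit of
`x • s₀` (the mirror of `doubleCoset_mk_stabilizer_eq_iff`, in the orientation of the dictionary
facts (D2)/(D3): `Π_v \ Π_𝒢 / Π′`, `Π_ℍ \ Π_𝒢 / Π′`). [cite: MochizukiSemiAnbd2006, Rem. 2.2.1 p.24] -/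
theorem doubleCoset_mk_right_stabilizer_eq_iff (s₀ : X) (H : Subgroup G) (x y : G) :
    DoubleCoset.mk H (MulAction.stabilizer G s₀) x = DoubleCoset.mk H (MulAction.stabilizer G s₀) y ↔
      y • s₀ ∈ MulAction.orbit H (x • s₀) := by
  rw [DoubleCoset.eq, MulAction.mem_orbit_iff]
  constructor
  · rintro ⟨h, hh, k, hk, rfl⟩
    refine ⟨⟨h, hh⟩, ?_⟩
    rw [Subgroup.mk_smul, mul_smul, mul_smul, MulAction.mem_stabilizer_iff.mp hk]
  · rintro ⟨⟨h, hh⟩, hk'⟩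
    rw [Subgroup.mk_smul] at hk'
    refine ⟨h, hh, (h * x)⁻¹ * y, ?_, by group⟩
    rw [MulAction.mem_stabilizer_iff, mul_smul, ← hk', inv_smul_eq_iff, mul_smul]

end Group

section Transport

variable {C : Type u₁} [Category.{u₂} C] {E : Type u₃} [Category.{u₄} E]
  (P : C ⥤ E) (Fe : E ⥤ FintypeCat.{w}) {F : C ⥤ FintypeCat.{w}} (α : P ⋙ Fe ≅ F)

/-- Components of the transported automorphism `Aut(α)(π₁(P) σ)`: `α⁻¹_X ≫ σ_{P X} ≫ α_X`.
[cite: MochizukiGeoAn2004, Def. 1.1.2(ii) p.10] -/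
theorem transport_pi1Map_hom_app (σ : Aut Fe) (X : C) :
    ((Aut.autMulEquivOfIso α) (pi1Map P Fe σ)).hom.app X =
      α.inv.app X ≫ σ.hom.app (P.obj X) ≫ α.hom.app X := rfl

/-- **Equivariance of the identification of basepoints.** For `σ ∈ Aut Fe` and `y ∈ Fe(P X)`:
`α_X(σ · y) = (Aut(α)(π₁(P) σ)) · α_X(y)` — the bijection `α_X : Fe(P X) ≃ F(X)` intertwines the
action of `Aut Fe` with that of its image `j(Aut Fe) ⊆ Aut F`, `j = Aut(α) ∘ π₁(P)`.
[cite: MochizukiGeoAn2004, Def. 1.1.2(ii) p.10] -/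
theorem transport_smul_app (σ : Aut Fe) (X : C) (y : Fe.obj (P.obj X)) :
    α.hom.app X (σ.hom.app (P.obj X) y) =
      ((Aut.autMulEquivOfIso α) (pi1Map P Fe σ)).hom.app X (α.hom.app X y) := by
  have h := ConcreteCategory.congr_hom (α.hom_inv_id_app X) y
  simp only [FintypeCat.comp_apply, FintypeCat.id_apply] at h
  -- `h : α.inv.app X (α.hom.app X y) = y`
  rw [transport_pi1Map_hom_app]
  change α.hom.app X (σ.hom.app (P.obj X) y) =
    α.hom.app X (σ.hom.app (P.obj X) (α.inv.app X (α.hom.app X y)))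
  rw [h]

/-- `α_X` is injective (it is a component of an isomorphism). [folklore] -/
private theorem transport_app_injective (X : C) : Function.Injective (α.hom.app X) := fun a b hab => by
  have ha := ConcreteCategory.congr_hom (α.hom_inv_id_app X) a
  have hb := ConcreteCategory.congr_hom (α.hom_inv_id_app X) b
  simp only [FintypeCat.comp_apply, FintypeCat.id_apply] at ha hb
  rw [← ha, ← hb]
  exact congrArg (α.inv.app X) hab

/-- The `Aut Fe`-orbit of `y ∈ Fe(P X)` is carried by `α_X` onto the `j(Aut Fe)`-orbit of `α_X y`,
`j = Aut(α) ∘ π₁(P)`: membership form. [cite: MochizukiSemiAnbd2006, Rem. 2.2.1 p.24] -/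
theorem mem_orbit_range_iff_of_transport (X : C) (y y' : Fe.obj (P.obj X)) :
    α.hom.app X y' ∈ MulAction.orbit
        ((Aut.autMulEquivOfIso α).toMonoidHom.comp (pi1Map P Fe)).range (α.hom.app X y) ↔
      y' ∈ MulAction.orbit (Aut Fe) y := by
  constructor
  · rintro ⟨⟨_, σ, rfl⟩, hσ⟩
    refine ⟨σ, transport_app_injective P Fe α X ?_⟩
    change α.hom.app X (σ.hom.app (P.obj X) y) = α.hom.app X y'
    rw [transport_smul_app P Fe α σ X y]
    exact hσ
  · rintro ⟨σ, rfl⟩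
    refine ⟨⟨_, σ, rfl⟩, ?_⟩
    change ((Aut.autMulEquivOfIso α) (pi1Map P Fe σ)).hom.app X (α.hom.app X y) =
      α.hom.app X (σ.hom.app (P.obj X) y)
    rw [transport_smul_app P Fe α σ X y]

end Transport

section Mono

variable {E : Type u₃} [Category.{u₄} E] (Fe : E ⥤ FintypeCat.{w})

/-- Orbits pull back along the fibre map of a morphism `m` when `Fe(m)` is injective (e.g. `m` a
monomorphism and `Fe` a fibre functor): if `Fe(m) q'` lies in the `Aut Fe`-orbit of `Fe(m) q`,
then `q'` lies in the orbit of `q`. [cite: MochizukiSemiAnbd2006, Rem. 2.2.1 p.24] -/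
theorem mem_orbit_of_map_mem_orbit {Y Z : E} (m : Y ⟶ Z) (hm : Function.Injective (Fe.map m))
    (q q' : Fe.obj Y) (h : Fe.map m q' ∈ MulAction.orbit (Aut Fe) (Fe.map m q)) :
    q' ∈ MulAction.orbit (Aut Fe) q := by
  obtain ⟨σ, hσ⟩ := h
  refine ⟨σ, hm ?_⟩
  rw [← mulAction_naturality]
  exact hσ

/-- … and push forward: `Fe(m)` maps the orbit of `q` into the orbit of `Fe(m) q`.
[cite: MochizukiSemiAnbd2006, Rem. 2.2.1 p.24] -/
theorem map_mem_orbit_of_mem_orbit {Y Z : E} (m : Y ⟶ Z) (q q' : Fe.obj Y)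
    (h : q' ∈ MulAction.orbit (Aut Fe) q) :
    Fe.map m q' ∈ MulAction.orbit (Aut Fe) (Fe.map m q) := by
  obtain ⟨σ, rfl⟩ := h
  exact ⟨σ, mulAction_naturality Fe σ m q⟩

end Mono

end Literature.AnabelianGeometry.Anabelioids
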